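import Literature.GroupTheory.CombinatorialGroupTheory.CyclicBlockInterchangeEncoding
import Literature.GroupTheory.CombinatorialGroupTheory.CyclicBlockInterchangeReduction
import HarnessLib

/-!
# CBI over four letters reduces to CBI over two letters (Heuer 2020, Thm. 3 via Lemma 4.6)

[Heuer2020, §4.2]: "we reduce CBI-`A` to CBI for binary alphabets, thus proving Theorem 3": the
map `(v, w, n) ↦ (λ(v), λ(w), n)` with the encoding `λ` of Lemma 4.6. With
`CyclicBlockInterchangeEncoding.lean` (`d_cbi(λv, λw) = d_cbi(v, w)` whenever the repetition `K`
exceeds `4 d_cbi(v, w)`, and relatedness is reflected) this file builds the **Karp reduction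
CBI-`F₄ ≤ₚ` CBI-`F₂`** in the tree's `FP` string algebra:

* the instance map `CBIBin.redFn`: on a well-formed instance `⟨⟨code v, code w⟩, 1ᵏ⟩` with
  `|v| = |w| = n` output the CBI-`F₂` instance code of `(λ(v), λ(w), min(k, n))` with exponents
  `ε(a) = a + 1` and repetition `K = 4n + 1` (capping `k` at `n` is harmless as `d_cbi ≤ n`, and
  makes `K > 4k`); anything else goes to a fixed no-instance;
* `redFn ∈ FP` (nested bounded concatenation loops), its value (`redFn_code`), and
  **`cbiLanguage_four_karpReducible_two : cbiLanguage 4 ≤ₚ cbiLanguage 2`**;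
* the bookkeeping for the named fact: `Heuer2020_clNPComplete_of_cbi_four_isNPHard` — with
  `CyclicBlockInterchangeReduction.lean`, NP-hardness of CBI-`F₄` (the four-letter case of
  [Heuer2020, Thm. 3], printed via 3-PARTITION, §4.1) now implies `Heuer2020_clNPComplete`.

Everything here is proved; no named facts.

## References

* [Heuer2020] N. Heuer, *Computing commutator length is hard*, arXiv:2001.10230, §4.2 (Lemma 4.6,
  proof of Thm. 3), §5.
-/

noncomputable section

namespace Literature.GroupTheory.CombinatorialGroupTheory

open _root_.Computability Literature.Computability.Complexity Literature.Computability.Complexity.Brick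
  Literature.Computability.Complexity.HashBricks Literature.Computability.Complexity.Plumb
  Literature.Computability.Complexity.OracleCompose Polynomial
open scoped Literature.Computability.Complexity.Notation

namespace CBIBin

open CLNP CBIRed

/-- The exponents of the binary encoding: `ε(a) = a + 1` (injective, `≥ 1`; the printed
`2, 3, 4, 5` would do equally well). [cite: Heuer2020, §4.2] -/
def eps (a : Fin 4) : ℕ := a.val + 1

/-- `ε` is injective. [folklore] -/
theorem eps_injective : Function.Injective eps := fun a b h => Fin.ext (by simpa [eps] using h)

/-- `ε ≥ 1`. [folklore] -/
theorem one_le_eps (a : Fin 4) : 1 ≤ eps a := Nat.le_add_left 1 _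

/-! ### The letter codes over `F₂` of the binary letters `x = 0`, `y = 1` -/

/-- The code of `x`. [folklore] -/
def LX : List Bool := clLetterCode 2 ((0 : Fin 2), true)
/-- The code of `y`. [folklore] -/
def LY : List Bool := clLetterCode 2 ((1 : Fin 2), true)

/-- The code of a positive binary word is the concatenation of `LX`/`LY`. [folklore] -/
theorem clWordCode_pos_cons (b : Fin 2) (u : List (Fin 2)) :
    clWordCode 2 (CBI.pos (b :: u)) = clLetterCode 2 (b, true) ++ clWordCode 2 (CBI.pos u) := by
  simp [CBI.pos, clWordCode]

/-- The code of `x y^e x`. [folklore] -/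
theorem clWordCode_pos_hcode (a : Fin 4) :
    clWordCode 2 (CBI.pos (CBI.hcode eps a)) = LX ++ ((List.replicate (eps a) LY).flatten ++ LX) := by
  rw [CBI.hcode, clWordCode_pos_cons, LX]
  congr 1
  induction eps a with
  | zero => simp [CBI.pos, clWordCode]
  | succ e ih =>
    rw [List.replicate_succ, List.cons_append, clWordCode_pos_cons, ih, List.replicate_succ, List.flatten_cons,
      List.append_assoc]
    rfl

/-- The code of a concatenation of positive words. [folklore] -/
theorem clWordCode_pos_append (u u' : List (Fin 2)) :
    clWordCode 2 (CBI.pos (u ++ u')) = clWordCode 2 (CBI.pos u) ++ clWordCode 2 (CBI.pos u') := by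
  simp [CBI.pos, clWordCode]

/-- The code of `K` copies. [folklore] -/
theorem clWordCode_pos_flatten_replicate (K : ℕ) (c : List (Fin 2)) :
    clWordCode 2 (CBI.pos (List.replicate K c).flatten) = (List.replicate K (clWordCode 2 (CBI.pos c))).flatten := by
  induction K with
  | zero => simp [CBI.pos, clWordCode]
  | succ K ih => rw [List.replicate_succ, List.flatten_cons, clWordCode_pos_append, ih, List.replicate_succ, List.flatten_cons]

/-! ### The machine -/

section Machine

/-- On `y = ⟨x, 1⟩`: `1ᴷ`, `K = 4|w| + 1`. [folklore] -/
def KFn : List Bool → List Bool :=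
  List.cons true ∘ appF ∘ fanoutFn (appF ∘ fanoutFn (nF 4) (nF 4)) (appF ∘ fanoutFn (nF 4) (nF 4))

variable (sel : List Bool → List Bool)

/-- On `⟨y, 1ʲ⟩`: block `j` (width `5`) of the word code `sel y`. [folklore] -/
def blockS : List Bool → List Bool := blkAt 4 ∘ fanoutFn (fanoutFn (sel ∘ fstF) fun _ => []) sndF

/-- On `⟨y, 1ʲ⟩`: `[bit p of block j is set]`, i.e. the letter is `p`. [folklore] -/
def bitT (p : ℕ) : List Bool → List Bool :=
  eqPairFn ∘ fanoutFn (takeFn ∘ fanoutFn (fun _ => ones 1) (dropFn ∘ fanoutFn (fun _ => ones p) (blockS sel))) fun _ => [true]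

/-- On `⟨y, 1ʲ⟩`: `LY^{p+1}` if the letter is `p`, else `ε`. [folklore] -/
def itS (p : ℕ) : List Bool → List Bool := iteFn (bitT sel p) (fun _ => (List.replicate (p + 1) LY).flatten) fun _ => []

/-- On `⟨y, 1ʲ⟩`: the `F₂` word code of `x y^{ε(a)} x`, `a` the `j`-th letter. [cite: Heuer2020, §4.2] -/
def pieceS : List Bool → List Bool :=
  appF ∘ fanoutFn (fun _ => LX) (appF ∘ fanoutFn (itS sel 0) (appF ∘ fanoutFn (itS sel 1)
    (appF ∘ fanoutFn (itS sel 2) (appF ∘ fanoutFn (itS sel 3) fun _ => LX))))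

/-- On `⟨y, 1ʲ⟩`: `K` copies of that code (inner concatenation loop). [cite: Heuer2020, §4.2] -/
def repS : List Bool → List Bool :=
  sndPow 2 ∘ foldLoop appF (pieceS sel ∘ fstF) (X + 1) ∘
    fanoutFn id (fanoutFn (lenBinF ∘ KFn ∘ fstF) fun _ => boolPair [] [])

/-- On `y`: the `F₂` word code of `λ` of the selected word (outer concatenation loop). [cite: Heuer2020, §4.2] -/
def lamS : List Bool → List Bool :=
  sndPow 2 ∘ foldLoop appF (clipF 36 (repS sel)) X ∘ fanoutFn id (fanoutFn (lenBinF ∘ nF 4) fun _ => boolPair [] [])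

/-- On `y`: the CBI-`F₂` instance code of `(λ v, λ w, min(k, n))`. [cite: Heuer2020, §4.2] -/
def coreF : List Bool → List Bool :=
  fanoutFn (fanoutFn (lamS cvF) (lamS cwF)) (takeFn ∘ fanoutFn (nF 4) uF)

/-- The well-formedness test `[x = code((v,w),k) with |v| = |w|]`, by way of the evaluator test of
`CyclicBlockInterchangeReduction.lean` on `⟨x, 1⟩`. [folklore] -/
def okT : List Bool → List Bool := dT 4 ∘ fanoutFn id fun _ => [true]

/-- A fixed no-instance of CBI-`F₂` (unrelated words). [folklore] -/
def noCode : List Bool := cbiInstanceCode 2 (([0], []), 0)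

/-- **The reduction function** CBI-`F₄ →` CBI-`F₂`. [cite: Heuer2020, §4.2] -/
def redFn : List Bool → List Bool := iteFn okT (coreF ∘ fanoutFn id fun _ => [true]) fun _ => noCode

/-! #### Polynomial time -/

/-- `KFn ∈ FP`. [cite: AroraBarakCC2009, §1.3] -/
theorem KFn_mem_FP : KFn ∈ FP :=
  comp_mem_FP (cons_mem_FP true) (comp_mem_FP appF_mem_FP (fanoutFn_mem_FP
    (comp_mem_FP appF_mem_FP (fanoutFn_mem_FP (nF_mem_FP 4) (nF_mem_FP 4)))
    (comp_mem_FP appF_mem_FP (fanoutFn_mem_FP (nF_mem_FP 4) (nF_mem_FP 4)))))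

variable {sel} (hsel : sel ∈ FP)
include hsel

/-- `blockS ∈ FP`. [cite: AroraBarakCC2009, §1.3] -/
theorem blockS_mem_FP : blockS sel ∈ FP :=
  comp_mem_FP (blkAt_mem_FP 4) (fanoutFn_mem_FP (fanoutFn_mem_FP (comp_mem_FP hsel fstF_mem_FP) (const_mem_FP _)) sndF_mem_FP)

/-- `bitT ∈ FP`. [cite: AroraBarakCC2009, §1.3] -/
theorem bitT_mem_FP (p : ℕ) : bitT sel p ∈ FP :=
  comp_mem_FP eqPairFn_mem_FP (fanoutFn_mem_FP (comp_mem_FP takeFn_mem_FP (fanoutFn_mem_FP (const_mem_FP _)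
    (comp_mem_FP dropFn_mem_FP (fanoutFn_mem_FP (const_mem_FP _) (blockS_mem_FP hsel))))) (const_mem_FP _))

/-- `itS ∈ FP`. [cite: AroraBarakCC2009, §1.3] -/
theorem itS_mem_FP (p : ℕ) : itS sel p ∈ FP := iteFn_mem_FP (bitT_mem_FP hsel p) (const_mem_FP _) (const_mem_FP _)

/-- `pieceS ∈ FP`. [cite: AroraBarakCC2009, §1.3] -/
theorem pieceS_mem_FP : pieceS sel ∈ FP :=
  comp_mem_FP appF_mem_FP (fanoutFn_mem_FP (const_mem_FP _) (comp_mem_FP appF_mem_FP (fanoutFn_mem_FP (itS_mem_FP hsel 0)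
    (comp_mem_FP appF_mem_FP (fanoutFn_mem_FP (itS_mem_FP hsel 1) (comp_mem_FP appF_mem_FP (fanoutFn_mem_FP
      (itS_mem_FP hsel 2) (comp_mem_FP appF_mem_FP (fanoutFn_mem_FP (itS_mem_FP hsel 3) (const_mem_FP _))))))))))

omit hsel in
/-- `bitT` is one-bit. [folklore] -/
theorem oneBit_bitT (p : ℕ) : OneBit (bitT sel p) := oneBit_eqPairFn.comp _

omit hsel in
/-- Size of `itS`: at most `3 (p + 1)`. [folklore] -/
theorem length_itS_le (p : ℕ) (z : List Bool) : (itS sel p z).length ≤ 3 * (p + 1) := by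
  rw [itS, iteFn_of_oneBit (oneBit_bitT p)]
  split_ifs
  · rw [List.length_flatten, List.map_replicate, List.sum_replicate, smul_eq_mul]
    simp [LY, Nat.mul_comm]
  · simp

omit hsel in
/-- Size of `pieceS`: at most `36`. [folklore] -/
theorem length_pieceS_le (z : List Bool) : (pieceS sel z).length ≤ 36 := by
  simp only [pieceS, Function.comp_apply, fanoutFn_apply, appF_boolPair, List.length_append]
  have h0 := length_itS_le (sel := sel) 0 z
  have h1 := length_itS_le (sel := sel) 1 z
  have h2 := length_itS_le (sel := sel) 2 z
  have h3 := length_itS_le (sel := sel) 3 z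
  have hx : LX.length = 3 := by simp [LX]
  omega

/-- `repS ∈ FP`. [cite: AroraBarakCC2009, §1.3 (bounded loops)] -/
theorem repS_mem_FP : repS sel ∈ FP :=
  comp_mem_FP (sndPow_mem_FP 2) (comp_mem_FP
    (foldLoop_mem_FP (C := 36) appF_mem_FP length_appF_le (comp_mem_FP (pieceS_mem_FP hsel) fstF_mem_FP)
      (fun w => (length_pieceS_le (sel := sel) (fstF w)).trans (Nat.le_mul_of_pos_right _ (Nat.succ_pos _))) (X + 1))
    (fanoutFn_mem_FP id_mem_FP (fanoutFn_mem_FP (comp_mem_FP lenBinF_mem_FP (comp_mem_FP KFn_mem_FP fstF_mem_FP))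
      (const_mem_FP _))))

/-- `lamS ∈ FP` (clipped pieces). [cite: AroraBarakCC2009, §1.3 (bounded loops)] -/
theorem lamS_mem_FP : lamS sel ∈ FP :=
  comp_mem_FP (sndPow_mem_FP 2) (comp_mem_FP
    (foldLoop_clipF_mem_FP 36 appF_mem_FP length_appF_le (repS_mem_FP hsel) X)
    (fanoutFn_mem_FP id_mem_FP (fanoutFn_mem_FP (comp_mem_FP lenBinF_mem_FP (nF_mem_FP 4)) (const_mem_FP _))))

omit hsel

/-- `coreF ∈ FP`. [cite: AroraBarakCC2009, §1.3] -/
theorem coreF_mem_FP : coreF ∈ FP :=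
  fanoutFn_mem_FP (fanoutFn_mem_FP (lamS_mem_FP cvF_mem_FP) (lamS_mem_FP cwF_mem_FP))
    (comp_mem_FP takeFn_mem_FP (fanoutFn_mem_FP (nF_mem_FP 4) uF_mem_FP))

/-- `okT ∈ FP`. [cite: AroraBarakCC2009, §1.3] -/
theorem okT_mem_FP : okT ∈ FP := comp_mem_FP (dT_mem_FP 4) (fanoutFn_mem_FP id_mem_FP (const_mem_FP _))

/-- `okT` is one-bit. [folklore] -/
theorem oneBit_okT : OneBit okT := (oneBit_dT 4).comp _

/-- **`redFn ∈ FP`.** [cite: AroraBarakCC2009, §1.3] -/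
theorem redFn_mem_FP : redFn ∈ FP :=
  iteFn_mem_FP okT_mem_FP (comp_mem_FP coreF_mem_FP (fanoutFn_mem_FP id_mem_FP (const_mem_FP _))) (const_mem_FP _)

/-! #### Values on instance codes -/

section Values

variable (v w : List (Fin 4)) (k : ℕ)

/-- Value of `KFn`: `1^{4|w| + 1}`. [folklore] -/
theorem KFn_yCode (b : List Bool) : KFn (yCode v w k b) = ones (4 * w.length + 1) := by
  simp only [KFn, Function.comp_apply, fanoutFn_apply, appF_boolPair, nF_yCode]
  simp only [ones, List.replicate_append_replicate, ← List.replicate_succ]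
  congr 1
  omega

variable {v w k}

/-- One bit of a letter code of `F₄`. [folklore] -/
theorem take_one_drop_clLetterCode (a : Fin 4) {p : ℕ} (hp : p < 4) :
    ((clLetterCode 4 (a, true)).drop p).take 1 = [decide (a.val = p)] := by
  fin_cases a <;> interval_cases p <;> rfl

variable (sel : List Bool → List Bool) (y : List Bool) (j : ℕ)

/-- Value of `blockS`: block `j` of the selected code. [folklore] -/
theorem blockS_pair : blockS sel (boolPair y (ones j)) = ((sel y).drop (j * 5)).take 5 := by
  simp [blockS, blkAt_boolPair]

variable {sel y j} {a : Fin 4} (hblk : ((sel y).drop (j * 5)).take 5 = clLetterCode 4 (a, true))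
include hblk

/-- Truth of `bitT` on a letter block. [folklore] -/
theorem bitT_pair_iff {p : ℕ} (hp : p < 4) : bitT sel p (boolPair y (ones j)) = [true] ↔ a.val = p := by
  rw [bitT, Function.comp_apply, fanoutFn_apply, Function.comp_apply, fanoutFn_apply, Function.comp_apply, fanoutFn_apply,
    blockS_pair, hblk, dropFn_boolPair, List.length_replicate, takeFn_boolPair, List.length_replicate,
    take_one_drop_clLetterCode a hp, eqPairFn_boolPair_eq_true, List.cons.injEq]
  simp

/-- Value of `itS` on a letter block. [folklore] -/
theorem itS_pair {p : ℕ} (hp : p < 4) :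
    itS sel p (boolPair y (ones j)) = if a.val = p then (List.replicate (p + 1) LY).flatten else [] := by
  rw [itS, iteFn_of_oneBit (oneBit_bitT p)]
  by_cases h : a.val = p
  · rw [if_pos ((bitT_pair_iff hblk hp).2 h), if_pos h]
  · rw [if_neg (fun h' => h ((bitT_pair_iff hblk hp).1 h')), if_neg h]

/-- **Value of `pieceS` on a letter block**: the `F₂` code of `x y^{ε a} x`. [cite: Heuer2020, §4.2] -/
theorem pieceS_pair : pieceS sel (boolPair y (ones j)) = clWordCode 2 (CBI.pos (CBI.hcode eps a)) := by
  rw [clWordCode_pos_hcode, pieceS]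
  simp only [Function.comp_apply, fanoutFn_apply, appF_boolPair, itS_pair hblk (show 0 < 4 by decide),
    itS_pair hblk (show 1 < 4 by decide), itS_pair hblk (show 2 < 4 by decide), itS_pair hblk (show 3 < 4 by decide), eps]
  have ha := a.isLt
  rcases a with ⟨a, _⟩
  dsimp only at ha ⊢
  interval_cases a <;> simp

omit hblk

/-- A constant concatenation is the flattened replicate. [folklore] -/
theorem ccat_const (c : List Bool) : ∀ K : ℕ, ccat (fun _ => c) K = (List.replicate K c).flatten
  | 0 => rfl
  | K + 1 => by
    rw [ccat_succ, ccat_const c K, List.replicate_succ', List.flatten_append, List.flatten_singleton]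

/-- Length of a `ccat` with bounded pieces. [folklore] -/
theorem length_ccat_le {g : ℕ → List Bool} {B : ℕ} (h : ∀ j, (g j).length ≤ B) : ∀ K : ℕ, (ccat g K).length ≤ K * B
  | 0 => by simp
  | K + 1 => by
    rw [ccat_succ, List.length_append, Nat.succ_mul]
    exact Nat.add_le_add (length_ccat_le h K) (h K)

variable (v w : List (Fin 4)) (k : ℕ) (b : List Bool)

/-- The record of the reduction has all the letters of both words inside. [folklore] -/
theorem length_yCode_ge : 5 * v.length + 5 * w.length ≤ (yCode v w k b).length := by
  have h1 := length_fstF_sndF_le (yCode v w k b)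
  have h2 := length_fstF_sndF_le (fstF (yCode v w k b))
  have h3 := length_fstF_sndF_le (fstF (fstF (yCode v w k b)))
  have h4 : (fstF (fstF (fstF (yCode v w k b)))).length = 5 * v.length := by
    rw [← length_clWordCode_pos, ← cvF_yCode v w k b]; rfl
  have h5 : (sndF (fstF (fstF (yCode v w k b)))).length = 5 * w.length := by
    rw [← length_clWordCode_pos, ← cwF_yCode v w k b]; rfl
  omega

variable {v w k b}

/-- **Value of `repS` on a letter block**: the `F₂` code of `K` copies of `x y^{ε a} x`. [cite: Heuer2020, §4.2] -/
theorem repS_pair {sel : List Bool → List Bool} {j : ℕ} {a : Fin 4}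
    (hblk : ((sel (yCode v w k b)).drop (j * 5)).take 5 = clLetterCode 4 (a, true)) :
    repS sel (boolPair (yCode v w k b) (ones j)) =
      clWordCode 2 (CBI.pos (List.replicate (4 * w.length + 1) (CBI.hcode eps a)).flatten) := by
  set y := yCode v w k b with hy
  set zz := boolPair y (ones j) with hzz
  have hinit : fanoutFn id (fanoutFn (lenBinF ∘ KFn ∘ fstF) fun _ => boolPair [] []) zz =
      boolPair zz (boolPair (encodeNat (4 * w.length + 1)) (boolPair (ones 0) [])) := by
    simp [hzz, hy, KFn_yCode, ones]
  have hlen : 4 * w.length + 1 ≤ (X + 1 : Polynomial ℕ).eval zz.length := by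
    rw [eval_add, eval_X, eval_one, hzz, length_boolPair]
    have := length_yCode_ge v w k b
    rw [← hy] at this
    omega
  rw [repS, Function.comp_apply, Function.comp_apply, hinit, foldLoop_apply appF _ hlen 0 [], sndPow_succ_boolPair,
    sndPow_succ_boolPair, sndPow_zero_boolPair, foldAcc_appF, List.nil_append, clWordCode_pos_flatten_replicate]
  have : (fun m => (pieceS sel ∘ fstF) (boolPair zz (ones (0 + m)))) = fun _ => clWordCode 2 (CBI.pos (CBI.hcode eps a)) := by
    funext m
    rw [Function.comp_apply, fstF_boolPair, hzz, pieceS_pair hblk]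
  rw [this, ccat_const]

/-- The word code of `λ(v)`, letter by letter. [folklore] -/
theorem ccat_code_lam (K : ℕ) (u : List (Fin 4)) : ∀ n, n ≤ u.length →
    ccat (fun j => clWordCode 2 (CBI.pos (List.replicate K (CBI.hcode eps (u.getD j 0))).flatten)) n =
      clWordCode 2 (CBI.pos (CBI.lam eps K (u.take n)))
  | 0, _ => by simp [CBI.lam, CBI.pos, clWordCode]
  | n + 1, hn => by
    rw [ccat_succ, ccat_code_lam K u n (Nat.le_of_succ_le hn), List.take_succ_eq_append_getElem (Nat.lt_of_succ_le hn),
      CBI.lam_append, clWordCode_pos_append, CBI.lam_cons, CBI.lam_nil, List.append_nil, List.getD_eq_getElem _ _ (Nat.lt_of_succ_le hn)]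

/-- **Value of `lamS`**: the `F₂` word code of `λ` of the selected word. [cite: Heuer2020, §4.2] -/
theorem lamS_yCode {sel : List Bool → List Bool} {u : List (Fin 4)} (hsel : sel (yCode v w k b) = clWordCode 4 (CBI.pos u))
    (hu : u.length = w.length) :
    lamS sel (yCode v w k b) = clWordCode 2 (CBI.pos (CBI.lam eps (4 * w.length + 1) u)) := by
  set y := yCode v w k b with hy
  have hinit : fanoutFn id (fanoutFn (lenBinF ∘ nF 4) fun _ => boolPair [] []) y =
      boolPair y (boolPair (encodeNat w.length) (boolPair (ones 0) [])) := by
    simp [hy, ones]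
  have hylen := length_yCode_ge v w k b
  rw [← hy] at hylen
  have hlen : w.length ≤ (X : Polynomial ℕ).eval y.length := by rw [eval_X]; omega
  have hblk : ∀ j (hj : j < w.length), ((sel y).drop (j * 5)).take 5 = clLetterCode 4 (u[j]'(by rw [hu]; exact hj), true) := by
    intro j hj
    rw [hsel]
    exact take_drop_clWordCode_pos (by rw [hu]; exact hj)
  rw [lamS, Function.comp_apply, Function.comp_apply, hinit, foldLoop_apply appF _ hlen 0 [], sndPow_succ_boolPair,
    sndPow_succ_boolPair, sndPow_zero_boolPair, foldAcc_clipF (fun j _ hj => ?_), foldAcc_appF, List.nil_append]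
  · rw [show CBI.lam eps (4 * w.length + 1) u = CBI.lam eps (4 * w.length + 1) (u.take w.length) by
      rw [List.take_of_length_le (by omega)], ← ccat_code_lam _ u w.length (by omega)]
    refine ccat_congr fun j hj => ?_
    rw [Nat.zero_add, hy, repS_pair (hblk j hj), List.getD_eq_getElem _ _ (by rw [hu]; exact hj)]
  · -- the genuine pieces are short: `18 (4n+1) ≤ 36 (|y| + 1)`
    rw [Nat.zero_add] at hj
    rw [hy, repS_pair (hblk j hj), ← hy, length_clWordCode_pos, CBI.length_flatten_replicate, CBI.length_hcode, eps]
    have ha : (u[j]'(by rw [hu]; exact hj)).val < 4 := (u[j]'(by rw [hu]; exact hj)).isLt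
    have : (4 * w.length + 1) * ((u[j]'(by rw [hu]; exact hj)).val + 1 + 2) ≤ (4 * w.length + 1) * 6 :=
      Nat.mul_le_mul_left _ (by omega)
    nlinarith

/-- **Value of the core map on an instance code**: the CBI-`F₂` instance code of
`(λ v, λ w, min(|w|, k))`. [cite: Heuer2020, §4.2] -/
theorem coreF_yCode (hn : w.length = v.length) :
    coreF (yCode v w k b) =
      cbiInstanceCode 2 ((CBI.lam eps (4 * w.length + 1) v, CBI.lam eps (4 * w.length + 1) w), min w.length k) := by
  rw [coreF, fanoutFn_apply, fanoutFn_apply, lamS_yCode (u := v) (cvF_yCode v w k b) hn.symm,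
    lamS_yCode (u := w) (cwF_yCode v w k b) rfl, Function.comp_apply, fanoutFn_apply, nF_yCode, uF_yCode, takeFn_boolPair,
    List.length_replicate, cbiInstanceCode]
  simp [ones, OracleCompose.unaryEncodeNat_eq_replicate, List.take_replicate]

end Values

/-! #### Truth of the well-formedness test and the Karp reduction -/

/-- **Truth of `okT`**: `x` codes an instance with words of equal length. [folklore] -/
theorem okT_true_iff (x : List Bool) :
    okT x = [true] ↔ ∃ (v w : List (Fin 4)) (k : ℕ), w.length = v.length ∧ x = cbiInstanceCode 4 ((v, w), k) := by
  rw [okT, Function.comp_apply, fanoutFn_apply, dT_true_iff]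
  constructor
  · rintro ⟨v, w, k, b, hlen, hy, -⟩
    have h := boolPair_injective (a₁ := (x, [true])) (a₂ := (cbiInstanceCode 4 ((v, w), k), b)) hy
    simp only [Prod.mk.injEq] at h
    exact ⟨v, w, k, hlen, h.1⟩
  · rintro ⟨v, w, k, hlen, rfl⟩
    refine ⟨v, w, k, [true], hlen, rfl, ?_⟩
    rcases v with _ | ⟨a, v⟩
    · exact Or.inl rfl
    · exact Or.inr (by simp)

/-- The no-instance is a no-instance. [folklore] -/
theorem noCode_not_mem : noCode ∉ cbiLanguage 2 := by
  rw [noCode, cbiInstanceCode_mem_cbiLanguage_iff]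
  rintro ⟨hperm, -⟩
  simpa using hperm.length_eq

/-- **CBI-`F₄ ≤ₚ` CBI-`F₂`** (the encoding `λ` with `K = 4n + 1` copies and the threshold capped
at `n`; [Heuer2020, Lemma 4.6 and proof of Thm. 3]). [cite: Heuer2020, Thm. 3] -/
theorem cbiLanguage_four_karpReducible_two : cbiLanguage 4 ≤ₚ cbiLanguage 2 := by
  refine polyTimeKarpReducible_iff.2 ⟨redFn, redFn_mem_FP, fun x => ?_⟩
  by_cases hx : okT x = [true]
  · obtain ⟨v, w, k, hlen, rfl⟩ := (okT_true_iff x).1 hx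
    rw [redFn, iteFn_apply_true hx, Function.comp_apply, fanoutFn_apply, id_eq, show boolPair (cbiInstanceCode 4 ((v, w), k)) [true] =
      yCode v w k [true] from rfl, coreF_yCode (b := [true]) hlen, cbiInstanceCode_mem_cbiLanguage_iff,
      cbiInstanceCode_mem_cbiLanguage_iff]
    change (List.Perm v w ∧ CBI.dcbi v w ≤ k) ↔
      (List.Perm (CBI.lam eps (4 * w.length + 1) v) (CBI.lam eps (4 * w.length + 1) w) ∧
        CBI.dcbi (CBI.lam eps (4 * w.length + 1) v) (CBI.lam eps (4 * w.length + 1) w) ≤ min w.length k)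
    rw [CBI.lam_yes_iff eps_injective one_le_eps hlen (min_le_left _ _ |>.trans_eq hlen) (by rw [hlen]; omega)]
    constructor
    · rintro ⟨hp, hd⟩
      exact ⟨hp, le_min (hlen ▸ (CBI.dcbi_le_length hp)) hd⟩
    · rintro ⟨hp, hd⟩
      exact ⟨hp, hd.trans (min_le_right _ _)⟩
  · rw [redFn, iteFn_of_oneBit oneBit_okT, if_neg hx]
    constructor
    · rintro ⟨⟨⟨v, w⟩, k⟩, ⟨hperm, -⟩, rfl⟩
      exact absurd ((okT_true_iff _).2 ⟨v, w, k, hperm.length_eq.symm, rfl⟩) hx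
    · intro h
      exact absurd h noCode_not_mem

/-- NP-hardness descends along the reduction: if CBI-`F₄` is NP-hard then so is CBI-`F₂`. [cite: Heuer2020, Thm. 3] -/
theorem isNPHard_cbiLanguage_two_of_four (h : IsNPHard (cbiLanguage 4)) : IsNPHard (cbiLanguage 2) :=
  fun L hL => PolyTimeKarpReducible.trans_holds (h L hL) cbiLanguage_four_karpReducible_two

end Machine

end CBIBin

/-- **What the named fact now needs**: NP-hardness of CBI over FOUR letters — the case of
[Heuer2020, Thm. 3] proved in §4.1 from 3-PARTITION — implies `Heuer2020_clNPComplete`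
(CBI-`F₄ ≤ₚ` CBI-`F₂ ≤ᵀₚ` CL-`F₂`, then the rank climbs). [cite: Heuer2020, Thm. 1 and §5] -/
theorem Heuer2020_clNPComplete_of_cbi_four_isNPHard (h : IsNPHard (cbiLanguage 4)) : Heuer2020_clNPComplete :=
  Heuer2020_clNPComplete_of_cbi_isNPHard (CBIBin.isNPHard_cbiLanguage_two_of_four h)


end Literature.GroupTheory.CombinatorialGroupTheory

end
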